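import Summits.QuantumFields.BalabanUV.Beta.GAN24.CombLegFaceSawtoothBlockL1

/-!
# `BalabanUV.Beta.GAN24.CombLegEnvelope` — binder row G-an2-4 ∕ (CONV-C), TRANSFER-III (the (III′) column of RULING R-gan24p1-g46-2), THE COMB LEG DICTIONARY, FOURTH WORD:
# **THE CONJUGATED (COMB-CHART) COMPOSITE LEG FAMILIES ARE LOCALISED IN UNITS ON THE SCALE OF THE SOURCE BLOCKS** — the (III′) twin of leaf-01 g57's
# `GAN24/DressedLegEnvelope.exists_legChain_envelope` (CT-2 in kernel form): `|legChain (j ↦ legComp ψ♭ R_j) m k μ z κ u| ≤ K·(k+1)·(Lc^{4(k+1)})⁻¹·e^{−κ₀‖quo (Lc^(k+1)) u − z‖∞}`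
# (OWNER `b2b-balaban-gan24-p1` gen 47; no existing file touched)

NOT IN PRINT; OUR BOOKKEEPING ([folklore] triangle inequalities BY NAME over the first word's decomposition, leaf-03 g41's `legAct_legChain_respStepBm`, leaf-01 g57's
`Psi_single_envelope`, the second word's `abs_axProjBmAt_respStep_single_le` ∕ `abs_dz_PsiFaceTerm_single_le`, leaf-12's (N1) letter; 0 `def`, 0 cited facts, 0 `def … : Prop`,
0 sorry).  HONEST FRAMING (cell contract, verbatim): «discharging `BetaPertH` makes Bałaban's UV stability UNCONDITIONAL — a real constructive-QFT result; it is NOT the continuum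
limit and NOT the Clay problem.»  HONEST DEPENDENCY (verbatim): «continuum YM on T⁴ ⇐ BetaPertH ∧ nine spine estimates (0/9 proved); BetaPertH ⇐ (D1) ∧ (D4) ∧ CAP+tail;
G-an2-4 gates asym, D1 and NE2/3/4.»

WHY.  The third word gave the conjugated legs in BLOCK-ℓ¹ (the kernel-leg hypothesis `hρ` of the (H1♮) core).  The multiplier-column windows (the OWNER's part 3b
`DressedLegMultiplierColumnEnvelope`, input of part 4 `CarrierKernelLegBlockL1.kChain_dressed_inr_succ`) read the UPPER chain in SUP against the bottom leg's multiplier block; at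
(III′) the upper chain is the conjugated one (the second word's analysis: `krow (Ψ̂_S K Ψ̂_Sᵀ)` carries `ψ♭` on its field columns only), so its SUP envelope is the input the
part-3b ∕ part-4 twins will need.  In sup currency the face levels are NOT equal: level `i` has amplitude `∝ Lc^{−(5k+5−i)}`, each `≤ (Lc^{4(k+1)})⁻¹` (the crude count used
here, `(k+1)`-linear; the geometric count would give `2·(Lc^{4k+5})⁻¹` at `2 ≤ Lc`).
WHAT (`d = 3`, `[NeZero Lc]`, in-block roots `r` (face weights of `Ψ̂_S`) and `ρ = toSite rr` (dressing); §1–§2 PARAMETRIC in leaf-12's (N1) data `κ₀ ≥ 0`, `C ≥ 0`):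
* §1 **`abs_dz_PsiFace_single_le`** — THE FACE SAWTOOTH IN SUP: `|dz (PsiFace r ρ Lc m k (single μ z)) κ y| ≤ 2·(k+1)·faceWtSum r Lc·(1 + 8·Lc·(e^{κ₀}+1))·e^{κ₀}·C·(Lc^{4(k+1)})⁻¹·
  e^{−κ₀‖quo (Lc^{k+1}) y − z‖∞}` for ALL `m k μ z κ y` (the second word's face jump summed over the `k+1` levels).
* §2 **`abs_legChain_psiLeg_single_le`** (`2 ≤ Lc`): `|legChain (j ↦ legComp ψ♭ R_j) m k μ z κ u| ≤ ((1 + 8·Lc·(e^{κ₀}+1))·C + 16·C·(e^{κ₀}+1)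
  + 2·(k+1)·faceWtSum r Lc·(1 + 8·Lc·(e^{κ₀}+1))·e^{κ₀}·C)·(Lc^{4(k+1)})⁻¹·e^{−κ₀‖quo (Lc^{k+1}) u − z‖∞}` — `Π^ρ_bm T^B` (second word §2, `(Lc^{5(k+1)})⁻¹ ≤ (Lc^{4(k+1)})⁻¹`),
  `dz Ψ` (leaf-01's `Psi_single_envelope` at `u + e_κ` and `u`, the unit shift costing `e^{κ₀}`), `dz PsiFace` (§1).
* §3 **`exists_legChain_psiLeg_envelope`** (`2 ≤ Lc`) — leaf-12's rate `κ₀ > 0` and ONE `K ≥ 0`, uniform in both in-block roots, with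
  `|legChain (j ↦ legComp ψ♭ R_j) m k μ z κ u| ≤ K·(k+1)·(Lc^{4(k+1)})⁻¹·e^{−κ₀‖quo (Lc^(k+1)) u − z‖∞}` for ALL `r rr m k μ z κ u` — leaf-01's `exists_legChain_envelope` for the
  (III′) legs, with a `(k+1)`-linear constant.
Asserts NOTHING about Bałaban's tables; NOT the part-3b ∕ part-4 twins (next words), NOT a window, NOT a letter row; the (III′) campaign is NOT asked (an2 W-4) — typed while idle
under R-2; NEVER «G-an2-4 closed» as (CONV-C); NOT D1, NOT `BetaPertH`, NOT continuum, NOT Clay.  2026-08-25.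
-/

noncomputable section

open Finset
open scoped BigOperators
open Literature.MathematicalPhysics.QuantumFieldTheory
open Literature.MathematicalPhysics.QuantumFieldTheory.LatticeForm (quo)
open Literature.MathematicalPhysics.QuantumFieldTheory.Balaban1983to89
open Literature.MathematicalPhysics.QuantumFieldTheory.Balaban1983to89.Beta
open B4ContourShift (supNorm)
open AffineAveraging (Form0 Form1 Site box toSite unitVec dz)
open BalabanCompositeJets (respStep)
open Summit.QuantumFields.BalabanUV.Beta.AxialProjectorBlockMean (axProjBmAt)
open Summit.QuantumFields.BalabanUV.Beta.SymCorrectorKernel (psiKS)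
open Summit.QuantumFields.BalabanUV.Beta.SymCorrectorFace (faceWtSum faceWtSum_nonneg)
open Summit.QuantumFields.BalabanUV.Beta.GAN24.Push4 (legComp)
open Summit.QuantumFields.BalabanUV.Beta.GAN24.Push4Iter (legChain)
open Summit.QuantumFields.BalabanUV.Beta.GAN24.RespStepBmDecompLegs (legAct)
open Summit.QuantumFields.BalabanUV.Beta.GAN24.RespStepBmDecompExact (respStepBmSeq)
open Summit.QuantumFields.BalabanUV.Beta.GAN24.RespStepBmDecompPsi (Psi legAct_legChain_respStepBm)
open Summit.QuantumFields.BalabanUV.Beta.GAN24.RespStepDecay (exists_respStep_decay_and_grad)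
open Summit.QuantumFields.BalabanUV.Beta.GAN24.UndressedResponseUnits (inv_cast_pow_pow)
open Summit.QuantumFields.BalabanUV.Beta.GAN24.DressedLegEnvelope (legAct_single summable_single_and_le Psi_single_envelope)
open Summit.QuantumFields.BalabanUV.Beta.GAN24.StaircaseFaces (env_add_unitVec_le)
open Summit.QuantumFields.BalabanUV.Beta.GAN24.CombLegChainGauge (facePotential PsiFace legAct_legChain_psiLeg_eq)
open Summit.QuantumFields.BalabanUV.Beta.GAN24.CombLegFaceSawtoothBlockL1 (dz_PsiFace_apply abs_axProjBmAt_respStep_single_le abs_dz_PsiFaceTerm_single_le)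

namespace Summit.QuantumFields.BalabanUV.Beta.GAN24.CombLegEnvelope

section Four

variable {Lc : ℕ} [NeZero Lc] {κ₀ C : ℝ} (hκ : 0 ≤ κ₀) (hC : 0 ≤ C)
  (hN1 : ∀ (m k : ℕ) (μ : Fin (3 + 1)) (z : Site (3 + 1)) (l'' : Fin (3 + 1)) (w' : Site (3 + 1)),
    |respStep (d := 3) (Lc ^ m) (Lc ^ (m + k + 1)) μ z l'' w'| ≤
      C * ((Lc : ℝ) ^ (5 * (k + 1)))⁻¹ * Real.exp (-(κ₀ * supNorm (quo (Lc ^ (k + 1)) w' - z))))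
  {r : Fin (3 + 1) → ℕ} (hr : r ∈ box (3 + 1) Lc) {rr : Fin (3 + 1) → ℕ} (hrr : rr ∈ box (3 + 1) Lc)
include hκ hC hN1 hr hrr

/-! ## §1 The face sawtooth in sup -/

/-- NOT IN PRINT; OUR BOOKKEEPING.  **THE FACE SAWTOOTH OF THE CONJUGATED LEGS IN SUP** (`d = 3`, in-block roots; parametric in (N1)): for ALL `m k μ z κ y`,
`|dz (PsiFace r ρ Lc m k (single μ z)) κ y| ≤ 2·(k+1)·faceWtSum r Lc·(1 + 8·Lc·(e^{κ₀}+1))·e^{κ₀}·C·(Lc^{4(k+1)})⁻¹·e^{−κ₀‖quo (Lc^{k+1}) y − z‖∞}` — the second word's level-`i` face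
jump (`≤ 2·amplitude_i·e^{κ₀}·E` on the faces, `0` off them), each amplitude `(Lc^{5(k−i+1)})⁻¹·(Lc^{4i})⁻¹ ≤ (Lc^{4(k+1)})⁻¹`, summed over the `k+1` levels. -/
theorem abs_dz_PsiFace_single_le (m k : ℕ) (μ : Fin (3 + 1)) (z : Site (3 + 1)) (κ : Fin (3 + 1)) (y : Site (3 + 1)) :
    |dz (PsiFace r (toSite rr) Lc m k (fun μ' y => if μ' = μ then (if y = z then (1 : ℝ) else 0) else 0)) κ y|
      ≤ 2 * ((k : ℝ) + 1) * faceWtSum r Lc * (1 + 8 * (Lc : ℝ) * (Real.exp κ₀ + 1)) * Real.exp κ₀ * C * ((Lc : ℝ) ^ (4 * (k + 1)))⁻¹ *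
          Real.exp (-(κ₀ * supNorm (quo (Lc ^ (k + 1)) y - z))) := by
  have hL1 : (1 : ℝ) ≤ Lc := by exact_mod_cast Nat.one_le_iff_ne_zero.2 (NeZero.ne Lc)
  have hF0 := faceWtSum_nonneg r Lc
  set E : ℝ := Real.exp (-(κ₀ * supNorm (quo (Lc ^ (k + 1)) y - z))) with hE
  have hE0 : 0 ≤ E := (Real.exp_pos _).le
  rw [dz_PsiFace_apply]
  refine (Finset.abs_sum_le_sum_abs _ _).trans ?_
  have hterm : ∀ i ∈ Finset.range (k + 1),
      |((Lc : ℝ) ^ ((3 + 1) * i))⁻¹ *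
          facePotential r Lc (legAct (legChain (respStepBmSeq (d := 3) (toSite rr) Lc) (m + i) (k - i))
            (fun μ' y => if μ' = μ then (if y = z then (1 : ℝ) else 0) else 0)) (AveragingContours.blk (Lc ^ i) (y + unitVec κ))
        - ((Lc : ℝ) ^ ((3 + 1) * i))⁻¹ *
          facePotential r Lc (legAct (legChain (respStepBmSeq (d := 3) (toSite rr) Lc) (m + i) (k - i))
            (fun μ' y => if μ' = μ then (if y = z then (1 : ℝ) else 0) else 0)) (AveragingContours.blk (Lc ^ i) y)|
        ≤ 2 * faceWtSum r Lc * (1 + 8 * (Lc : ℝ) * (Real.exp κ₀ + 1)) * Real.exp κ₀ * C * ((Lc : ℝ) ^ (4 * (k + 1)))⁻¹ * E := by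
    intro i hi
    have hik : i ≤ k := Nat.lt_succ_iff.1 (Finset.mem_range.1 hi)
    refine (abs_dz_PsiFaceTerm_single_le hκ hC hN1 hr hrr m k i hik μ z κ y).trans ?_
    have hpow : ((Lc : ℝ) ^ (5 * (k - i + 1)))⁻¹ * ((Lc : ℝ) ^ ((3 + 1) * i))⁻¹ ≤ ((Lc : ℝ) ^ (4 * (k + 1)))⁻¹ := by
      rw [← mul_inv, ← pow_add]
      exact inv_anti₀ (by positivity) (pow_le_pow_right₀ hL1 (by omega))
    have hK0 : 0 ≤ 2 * faceWtSum r Lc * (1 + 8 * (Lc : ℝ) * (Real.exp κ₀ + 1)) * C * Real.exp κ₀ * E := by positivity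
    split_ifs
    · calc _ = (2 * faceWtSum r Lc * (1 + 8 * (Lc : ℝ) * (Real.exp κ₀ + 1)) * C * Real.exp κ₀ * E) *
              (((Lc : ℝ) ^ (5 * (k - i + 1)))⁻¹ * ((Lc : ℝ) ^ ((3 + 1) * i))⁻¹) := by ring
        _ ≤ (2 * faceWtSum r Lc * (1 + 8 * (Lc : ℝ) * (Real.exp κ₀ + 1)) * C * Real.exp κ₀ * E) * ((Lc : ℝ) ^ (4 * (k + 1)))⁻¹ :=
            mul_le_mul_of_nonneg_left hpow hK0
        _ = _ := by ring
    · positivity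
  refine (Finset.sum_le_sum hterm).trans (le_of_eq ?_)
  rw [Finset.sum_const, Finset.card_range, nsmul_eq_mul]
  push_cast
  ring

/-! ## §2 The conjugated composite legs in sup, parametric in (N1) -/

/-- NOT IN PRINT; OUR BOOKKEEPING.  **THE CONJUGATED COMPOSITE LEG FAMILIES IN SUP, PARAMETRIC IN (N1)** (`d = 3`, `2 ≤ Lc`, in-block roots): for ALL `m k μ z κ u`,
`|legChain (j ↦ legComp ψ♭ R_j) m k μ z κ u| ≤ ((1 + 8·Lc·(e^{κ₀}+1))·C + 16·C·(e^{κ₀}+1) + 2·(k+1)·faceWtSum r Lc·(1 + 8·Lc·(e^{κ₀}+1))·e^{κ₀}·C)·(Lc^{4(k+1)})⁻¹·e^{−κ₀‖quo (Lc^{k+1}) u − z‖∞}`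
— the entry is the conjugated chain on the point datum (`legAct_single`) = `Π^ρ_bm T^B + dz Ψ + dz PsiFace` (first word + leaf-03); the three pieces by the second word's §2,
leaf-01's `Psi_single_envelope` (at `u + e_κ` and `u`), and §1. -/
theorem abs_legChain_psiLeg_single_le (hLc : 2 ≤ Lc) (m k : ℕ) (μ : Fin (3 + 1)) (z : Site (3 + 1)) (κ : Fin (3 + 1)) (u : Site (3 + 1)) :
    |legChain (fun j => legComp (fun α x κ u => psiKS r Lc u x (Sum.inl κ) (Sum.inl α)) (respStepBmSeq (d := 3) (toSite rr) Lc j)) m k μ z κ u|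
      ≤ ((1 + 8 * (Lc : ℝ) * (Real.exp κ₀ + 1)) * C + 16 * C * (Real.exp κ₀ + 1)
          + 2 * ((k : ℝ) + 1) * faceWtSum r Lc * (1 + 8 * (Lc : ℝ) * (Real.exp κ₀ + 1)) * Real.exp κ₀ * C) *
        ((Lc : ℝ) ^ (4 * (k + 1)))⁻¹ * Real.exp (-(κ₀ * supNorm (quo (Lc ^ (k + 1)) u - z))) := by
  have hL1 : (1 : ℝ) ≤ Lc := by exact_mod_cast Nat.one_le_iff_ne_zero.2 (NeZero.ne Lc)
  haveI : NeZero (Lc ^ (k + 1)) := ⟨pow_ne_zero _ (NeZero.ne Lc)⟩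
  obtain ⟨hsum, -⟩ := summable_single_and_le (d := 3) μ z
  set Φ : Site (3 + 1) → ℝ := fun w => Real.exp (-(κ₀ * supNorm (quo (Lc ^ (k + 1)) w - z))) with hΦ
  have hΦ0 : ∀ w, 0 ≤ Φ w := fun w => (Real.exp_pos _).le
  -- (a) the projector of the undressed column, one power traded
  have hpow : ((Lc : ℝ) ^ (5 * (k + 1)))⁻¹ ≤ ((Lc : ℝ) ^ (4 * (k + 1)))⁻¹ :=
    inv_anti₀ (by positivity) (pow_le_pow_right₀ hL1 (by omega))
  have hproj : |axProjBmAt (toSite rr) Lc (legAct (respStep (d := 3) (Lc ^ m) (Lc ^ (m + k + 1)))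
        (fun μ' y => if μ' = μ then (if y = z then (1 : ℝ) else 0) else 0)) κ u|
      ≤ (1 + 8 * (Lc : ℝ) * (Real.exp κ₀ + 1)) * C * ((Lc : ℝ) ^ (4 * (k + 1)))⁻¹ * Φ u := by
    refine (abs_axProjBmAt_respStep_single_le hκ hC hN1 hrr m k μ z κ u).trans ?_
    have h0 : 0 ≤ (1 + 8 * (Lc : ℝ) * (Real.exp κ₀ + 1)) * C := by positivity
    have := mul_le_mul_of_nonneg_left hpow (mul_nonneg h0 (hΦ0 u))
    nlinarith [this]
  -- (b) the accumulated inter-block gauge at `u + e_κ` and `u`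
  have hPsi : ∀ w : Site (3 + 1),
      |Psi (toSite rr) Lc m k (fun μ' y => if μ' = μ then (if y = z then (1 : ℝ) else 0) else 0) w| ≤ 16 * C * ((Lc : ℝ) ^ (4 * (k + 1)))⁻¹ * Φ w :=
    fun w => Psi_single_envelope (Lc := Lc) hLc hC hN1 hrr m k μ z w
  have hdz : |dz (Psi (toSite rr) Lc m k (fun μ' y => if μ' = μ then (if y = z then (1 : ℝ) else 0) else 0)) κ u|
      ≤ 16 * C * (Real.exp κ₀ + 1) * ((Lc : ℝ) ^ (4 * (k + 1)))⁻¹ * Φ u := by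
    show |Psi (toSite rr) Lc m k _ (u + unitVec κ) - Psi (toSite rr) Lc m k _ u| ≤ _
    have hA : 0 ≤ 16 * C * ((Lc : ℝ) ^ (4 * (k + 1)))⁻¹ := by positivity
    have h1 := (hPsi (u + unitVec κ)).trans (mul_le_mul_of_nonneg_left (env_add_unitVec_le (N := Lc ^ (k + 1)) hκ z u κ) hA)
    have h2 := hPsi u
    refine (abs_sub _ _).trans ((add_le_add h1 h2).trans (le_of_eq ?_))
    simp only [hΦ]
    ring
  -- (c) the face sawtooth
  have hface := abs_dz_PsiFace_single_le hκ hC hN1 hr hrr m k μ z κ u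
  rw [← legAct_single (legChain (fun j => legComp (fun α x κ u => psiKS r Lc u x (Sum.inl κ) (Sum.inl α))
      (respStepBmSeq (d := 3) (toSite rr) Lc j)) m k) μ z κ u,
    legAct_legChain_psiLeg_eq hr hrr k m hsum, legAct_legChain_respStepBm hrr m k hsum]
  simp only [Pi.add_apply]
  refine ((abs_add_le _ _).trans (add_le_add ((abs_add_le _ _).trans (add_le_add hproj hdz)) hface)).trans (le_of_eq ?_)
  simp only [hΦ]
  ring

/-! ## §3 CT-2 in kernel form for the (III′) legs: one rate, one root-free constant -/

omit hκ hC hN1 hr hrr in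
/-- NOT IN PRINT; OUR BOOKKEEPING.  **THE CONJUGATED (COMB-CHART) COMPOSITE LEG FAMILIES ARE LOCALISED IN UNITS ON THE SCALE OF THE SOURCE BLOCKS, UNIFORMLY IN THE PAIR OF
LEVELS AND IN BOTH IN-BLOCK ROOTS** (`d = 3`, `2 ≤ Lc`): leaf-12's rate `κ₀ > 0` and ONE `K ≥ 0` with, for every in-block `r`, `rr` and ALL `m k μ z κ u`,
`|legChain (j ↦ legComp ψ♭ R_j) m k μ z κ u| ≤ K·(k+1)·(Lc^{4(k+1)})⁻¹·e^{−κ₀‖quo (Lc^(k+1)) u − z‖∞}` — leaf-01 g57's `DressedLegEnvelope.exists_legChain_envelope` for the (III′) legs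
(§2 at leaf-12's (N1) data `RespStepDecay.exists_respStep_decay_and_grad`; `faceWtSum r Lc ≤ Σ_{r′ ∈ box} faceWtSum r′ Lc` makes `K` root-free; the constant is `(k+1)`-linear). -/
theorem exists_legChain_psiLeg_envelope (hLc : 2 ≤ Lc) :
    ∃ κ₀ K : ℝ, 0 < κ₀ ∧ 0 ≤ K ∧ ∀ (r : Fin (3 + 1) → ℕ), r ∈ box (3 + 1) Lc → ∀ (rr : Fin (3 + 1) → ℕ), rr ∈ box (3 + 1) Lc →
      ∀ (m k : ℕ) (μ : Fin (3 + 1)) (z : Site (3 + 1)) (κ : Fin (3 + 1)) (u : Site (3 + 1)),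
        |legChain (fun j => legComp (fun α x κ u => psiKS r Lc u x (Sum.inl κ) (Sum.inl α)) (respStepBmSeq (d := 3) (toSite rr) Lc j)) m k μ z κ u|
          ≤ K * ((k : ℝ) + 1) * ((Lc : ℝ) ^ (4 * (k + 1)))⁻¹ * Real.exp (-(κ₀ * supNorm (quo (Lc ^ (k + 1)) u - z))) := by
  classical
  obtain ⟨κ₀, C, C', hκ₀, hC, -, hN1', -⟩ := exists_respStep_decay_and_grad (Lc := Lc)
  have hN1 : ∀ (m k : ℕ) (μ : Fin (3 + 1)) (z : Site (3 + 1)) (l'' : Fin (3 + 1)) (w' : Site (3 + 1)),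
      |respStep (d := 3) (Lc ^ m) (Lc ^ (m + k + 1)) μ z l'' w'| ≤
        C * ((Lc : ℝ) ^ (5 * (k + 1)))⁻¹ * Real.exp (-(κ₀ * supNorm (quo (Lc ^ (k + 1)) w' - z))) := by
    intro m k μ z l'' w'
    have h := hN1' m k μ z l'' w'
    rwa [inv_cast_pow_pow] at h
  set W : ℝ := Real.exp κ₀ + 1 with hW
  set Fm : ℝ := ∑ r' ∈ box (3 + 1) Lc, faceWtSum r' Lc with hFm
  have hFm0 : 0 ≤ Fm := Finset.sum_nonneg fun r' _ => faceWtSum_nonneg r' Lc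
  have hA0 : 0 ≤ (1 + 8 * (Lc : ℝ) * W) * C := by positivity
  have hB0 : 0 ≤ 16 * C * W := by positivity
  have hD0 : 0 ≤ 2 * Fm * (1 + 8 * (Lc : ℝ) * W) * Real.exp κ₀ * C := by positivity
  refine ⟨κ₀, (1 + 8 * (Lc : ℝ) * W) * C + 16 * C * W + 2 * Fm * (1 + 8 * (Lc : ℝ) * W) * Real.exp κ₀ * C, hκ₀, by positivity, ?_⟩
  intro r hr rr hrr m k μ z κ u
  have hF : faceWtSum r Lc ≤ Fm := Finset.single_le_sum (fun r' _ => faceWtSum_nonneg r' Lc) hr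
  have hF0 := faceWtSum_nonneg r Lc
  refine (abs_legChain_psiLeg_single_le hκ₀.le hC hN1 hr hrr hLc m k μ z κ u).trans ?_
  rw [← hW]
  have hx0 : 0 ≤ ((Lc : ℝ) ^ (4 * (k + 1)))⁻¹ * Real.exp (-(κ₀ * supNorm (quo (Lc ^ (k + 1)) u - z))) := by positivity
  have hk0 : (0 : ℝ) ≤ k := Nat.cast_nonneg k
  have hG0 : 0 ≤ 2 * (1 + 8 * (Lc : ℝ) * W) * Real.exp κ₀ * C := by positivity
  rw [mul_assoc _ (((Lc : ℝ) ^ (4 * (k + 1)))⁻¹), mul_assoc _ (((Lc : ℝ) ^ (4 * (k + 1)))⁻¹)]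
  apply mul_le_mul_of_nonneg_right _ hx0
  have h3 : 2 * ((k : ℝ) + 1) * faceWtSum r Lc * (1 + 8 * (Lc : ℝ) * W) * Real.exp κ₀ * C
      ≤ 2 * Fm * (1 + 8 * (Lc : ℝ) * W) * Real.exp κ₀ * C * ((k : ℝ) + 1) := by
    have := mul_le_mul_of_nonneg_left hF (mul_nonneg hG0 (by positivity : (0 : ℝ) ≤ (k : ℝ) + 1))
    nlinarith [this]
  nlinarith [mul_nonneg hA0 hk0, mul_nonneg hB0 hk0, hA0, hB0, h3]

end Four

end Summit.QuantumFields.BalabanUV.Beta.GAN24.CombLegEnvelope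

end
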